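import Mathlib.InformationTheory.KullbackLeibler.Basic
import HarnessLib

/-!
# Route `ColdStartUniversality` (crux K_A1 stmt-QuantumFields-24809, line «cold_entropy», rung `stub_fixedCutoffEntropy`):
# KULLBACK–LEIBLER DIVERGENCE UNDER A ONE-SIDED DENSITY BOUND — budget and decay from total variation

Helper file (seat `ym-line-csu-p1`, g10; `--supports stmt-QuantumFields-24809`).  Route-independent measure theory for
Mathlib's `InformationTheory.klDiv` (through `klDiv_eq_lintegral_klFun_of_ac`, `klFun x = x log x + 1 − x`): if a
probability measure `ν` is dominated by a multiple of a probability measure `μ`, `ν ≤ D · μ` (`D ≥ 1`), then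

* `rnDeriv_le_const_of_le_smul` — `dν/dμ ≤ D` `μ`-a.e.;
* `klFun_le_mul_abs_sub_one` — the pointwise inequality `klFun x ≤ max(1, log D) · |x − 1|` on `[0, D]`
  (`x log x ≤ 0` below `1`; `log x ≤ x − 1` and `log x ≤ log D` above `1`);
* `klDiv_le_of_le_smul` — ENTROPY BUDGET: `KL(ν ‖ μ) ≤ max(1, log D) · (D + 1)` (finite, explicit);
* `integral_abs_rnDeriv_sub_one_le` — `∫ |dν/dμ − 1| dμ ≤ ε` as soon as `∫ g dν − ∫ g dμ ≤ ε` for every measurable `|g| ≤ 1`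
  (test on `g = sign(dν/dμ − 1)`);
* `klDiv_le_of_le_smul_of_integral_sub_le` — ENTROPY FROM TOTAL VARIATION under the density bound:
  `KL(ν ‖ μ) ≤ max(1, log D) · ε`.

THEOREMS ONLY, no sorry, standard axioms, [folklore].  Nothing here is specific to Yang–Mills; no crux or summit is proved;
the Yang–Mills mass gap is NOT proved.
-/

set_option autoImplicit false

noncomputable section

namespace Summit.QuantumFields.YangMills.Theorems.ColdStartUniversality.KLDensity

open MeasureTheory InformationTheory
open scoped ENNReal

variable {α : Type*} [MeasurableSpace α]

/-- **The pointwise inequality** `klFun x ≤ max(1, log D) · |x − 1|` for `0 ≤ x ≤ D`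
(`klFun x = x log x + 1 − x`). [folklore] -/
theorem klFun_le_mul_abs_sub_one {x D : ℝ} (hx0 : 0 ≤ x) (hxD : x ≤ D) :
    klFun x ≤ max 1 (Real.log D) * |x - 1| := by
  rcases le_total x 1 with hx1 | hx1
  · -- below `1`: `x log x ≤ 0`
    have hxlog : x * Real.log x ≤ 0 := mul_nonpos_of_nonneg_of_nonpos hx0 (Real.log_nonpos hx0 hx1)
    rw [abs_of_nonpos (sub_nonpos.2 hx1), klFun_apply]
    calc x * Real.log x + 1 - x ≤ 1 * -(x - 1) := by linarith
      _ ≤ max 1 (Real.log D) * -(x - 1) := mul_le_mul_of_nonneg_right (le_max_left _ _) (by linarith)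
  · -- above `1`: `log x ≤ x − 1` and `log x ≤ log D`
    rw [abs_of_nonneg (sub_nonneg.2 hx1), klFun_apply]
    have hxpos : 0 < x := lt_of_lt_of_le one_pos hx1
    have hlogx : Real.log x ≤ x - 1 := Real.log_le_sub_one_of_pos hxpos
    have hlogD : Real.log x ≤ Real.log D := Real.log_le_log hxpos hxD
    calc x * Real.log x + 1 - x = (x - 1) * Real.log x + (Real.log x + 1 - x) := by ring
      _ ≤ (x - 1) * Real.log x := by linarith
      _ ≤ (x - 1) * Real.log D := mul_le_mul_of_nonneg_left hlogD (sub_nonneg.2 hx1)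
      _ = Real.log D * (x - 1) := mul_comm _ _
      _ ≤ max 1 (Real.log D) * (x - 1) := mul_le_mul_of_nonneg_right (le_max_right _ _) (sub_nonneg.2 hx1)

/-- **A dominated measure has a bounded Radon–Nikodym derivative**: `ν ≤ c · μ` ⇒ `dν/dμ ≤ c` `μ`-a.e. [folklore] -/
theorem rnDeriv_le_const_of_le_smul {ν μ : Measure α} [SigmaFinite μ] {c : ℝ≥0∞} (h : ν ≤ c • μ) :
    ∀ᵐ x ∂μ, ν.rnDeriv μ x ≤ c := by
  refine ae_le_of_forall_setLIntegral_le_of_sigmaFinite (ν.measurable_rnDeriv μ) fun s _ _ => ?_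
  calc ∫⁻ x in s, ν.rnDeriv μ x ∂μ ≤ ν s := Measure.setLIntegral_rnDeriv_le s
    _ ≤ (c • μ) s := h s
    _ = ∫⁻ _x in s, c ∂μ := by rw [Measure.smul_apply, setLIntegral_const, smul_eq_mul]

/-- **Entropy budget under a density bound**: for probability measures `ν ≤ D · μ` (`D ≥ 1`),
`KL(ν ‖ μ) ≤ max(1, log D) · (D + 1)`; in particular it is finite. [folklore] -/
theorem klDiv_le_of_le_smul {ν μ : Measure α} [IsProbabilityMeasure ν] [IsProbabilityMeasure μ]
    {D : ℝ} (hD : 1 ≤ D) (h : ν ≤ (ENNReal.ofReal D) • μ) :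
    klDiv ν μ ≤ ENNReal.ofReal (max 1 (Real.log D) * (D + 1)) := by
  have hac : ν ≪ μ := Measure.absolutelyContinuous_of_le_smul h
  rw [klDiv_eq_lintegral_klFun_of_ac hac]
  have hbd := rnDeriv_le_const_of_le_smul h
  have hM0 : 0 ≤ max 1 (Real.log D) := le_trans zero_le_one (le_max_left _ _)
  calc ∫⁻ x, ENNReal.ofReal (klFun (ν.rnDeriv μ x).toReal) ∂μ
      ≤ ∫⁻ _x, ENNReal.ofReal (max 1 (Real.log D) * (D + 1)) ∂μ := by
        refine lintegral_mono_ae ?_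
        filter_upwards [hbd] with x hx
        refine ENNReal.ofReal_le_ofReal ?_
        have hx0 : 0 ≤ (ν.rnDeriv μ x).toReal := ENNReal.toReal_nonneg
        have hxD : (ν.rnDeriv μ x).toReal ≤ D := ENNReal.toReal_le_of_le_ofReal (by linarith) hx
        calc klFun (ν.rnDeriv μ x).toReal
            ≤ max 1 (Real.log D) * |(ν.rnDeriv μ x).toReal - 1| := klFun_le_mul_abs_sub_one hx0 hxD
          _ ≤ max 1 (Real.log D) * (D + 1) := by
              refine mul_le_mul_of_nonneg_left ?_ hM0
              calc |(ν.rnDeriv μ x).toReal - 1| ≤ |(ν.rnDeriv μ x).toReal| + |(1 : ℝ)| := abs_sub _ _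
                _ ≤ D + 1 := by rw [abs_of_nonneg hx0, abs_one]; linarith
    _ = ENNReal.ofReal (max 1 (Real.log D) * (D + 1)) := by rw [lintegral_const, measure_univ, mul_one]

/-- **Total variation in density form from the dual bound**: if `∫ g dν − ∫ g dμ ≤ ε` for every measurable `|g| ≤ 1`
and `ν ≪ μ` (probability measures), then `∫ |dν/dμ − 1| dμ ≤ ε` (test on `g = sign(dν/dμ − 1)`). [folklore] -/
theorem integral_abs_rnDeriv_sub_one_le {ν μ : Measure α} [IsProbabilityMeasure ν] [IsProbabilityMeasure μ]
    (hac : ν ≪ μ) {ε : ℝ}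
    (hε : ∀ g : α → ℝ, Measurable g → (∀ x, |g x| ≤ 1) → (∫ x, g x ∂ν) - ∫ x, g x ∂μ ≤ ε) :
    ∫ x, |(ν.rnDeriv μ x).toReal - 1| ∂μ ≤ ε := by
  set p : α → ℝ := fun x => (ν.rnDeriv μ x).toReal with hp
  have hpm : Measurable p := (ν.measurable_rnDeriv μ).ennreal_toReal
  have hpi : Integrable p μ := Measure.integrable_toReal_rnDeriv
  -- the test function `g = sign(p − 1)`
  set g : α → ℝ := fun x => if 1 ≤ p x then 1 else -1 with hg
  have hgm : Measurable g := Measurable.ite (measurableSet_le measurable_const hpm) measurable_const measurable_const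
  have hg1 : ∀ x, |g x| ≤ 1 := fun x => by
    by_cases hx : 1 ≤ p x
    · simp [hg, hx]
    · simp [hg, hx]
  have hgp : ∀ x, |p x - 1| = p x * g x - g x := fun x => by
    by_cases hx : 1 ≤ p x
    · simp only [hg, if_pos hx]
      rw [abs_of_nonneg (sub_nonneg.2 hx)]
      ring
    · simp only [hg, if_neg hx]
      rw [abs_of_neg (by linarith [lt_of_not_ge hx])]
      ring
  have hgiμ : Integrable g μ := (integrable_const (1 : ℝ)).mono' hgm.aestronglyMeasurable
    (ae_of_all _ fun x => by rw [Real.norm_eq_abs]; exact hg1 x)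
  have hpg : Integrable (fun x => p x * g x) μ :=
    hpi.mul_bdd hgm.aestronglyMeasurable (ae_of_all _ fun x => by rw [Real.norm_eq_abs]; exact hg1 x)
  -- `∫ g dν = ∫ p g dμ`
  have hνg : ∫ x, g x ∂ν = ∫ x, p x * g x ∂μ := (integral_toReal_rnDeriv_mul hac).symm
  calc ∫ x, |p x - 1| ∂μ = ∫ x, (p x * g x - g x) ∂μ := integral_congr_ae (ae_of_all _ fun x => hgp x)
    _ = (∫ x, g x ∂ν) - ∫ x, g x ∂μ := by rw [integral_sub hpg hgiμ, hνg]
    _ ≤ ε := hε g hgm hg1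

/-- ★ **Entropy from total variation under a density bound**: for probability measures with `ν ≤ D · μ` (`D ≥ 1`) and
`∫ g dν − ∫ g dμ ≤ ε` for every measurable `|g| ≤ 1`, `KL(ν ‖ μ) ≤ max(1, log D) · ε`
(`KL = ∫ klFun(dν/dμ) dμ` and `klFun x ≤ max(1, log D)|x − 1|` on `[0, D]`). [folklore] -/
theorem klDiv_le_of_le_smul_of_integral_sub_le {ν μ : Measure α} [IsProbabilityMeasure ν] [IsProbabilityMeasure μ]
    {D ε : ℝ} (hD : 1 ≤ D) (h : ν ≤ (ENNReal.ofReal D) • μ)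
    (hε : ∀ g : α → ℝ, Measurable g → (∀ x, |g x| ≤ 1) → (∫ x, g x ∂ν) - ∫ x, g x ∂μ ≤ ε) :
    klDiv ν μ ≤ ENNReal.ofReal (max 1 (Real.log D) * ε) := by
  have hac : ν ≪ μ := Measure.absolutelyContinuous_of_le_smul h
  set p : α → ℝ := fun x => (ν.rnDeriv μ x).toReal with hp
  have hpi : Integrable p μ := Measure.integrable_toReal_rnDeriv
  have hM0 : 0 ≤ max 1 (Real.log D) := le_trans zero_le_one (le_max_left _ _)
  have hbd := rnDeriv_le_const_of_le_smul h
  have hTV := integral_abs_rnDeriv_sub_one_le hac hε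
  rw [klDiv_eq_lintegral_klFun_of_ac hac]
  have habs : Integrable (fun x => max 1 (Real.log D) * |p x - 1|) μ :=
    ((hpi.sub (integrable_const 1)).abs).const_mul _
  calc ∫⁻ x, ENNReal.ofReal (klFun (ν.rnDeriv μ x).toReal) ∂μ
      ≤ ∫⁻ x, ENNReal.ofReal (max 1 (Real.log D) * |p x - 1|) ∂μ := by
        refine lintegral_mono_ae ?_
        filter_upwards [hbd] with x hx
        refine ENNReal.ofReal_le_ofReal ?_
        have hx0 : 0 ≤ (ν.rnDeriv μ x).toReal := ENNReal.toReal_nonneg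
        have hxD : (ν.rnDeriv μ x).toReal ≤ D := ENNReal.toReal_le_of_le_ofReal (by linarith) hx
        exact klFun_le_mul_abs_sub_one hx0 hxD
    _ = ENNReal.ofReal (∫ x, max 1 (Real.log D) * |p x - 1| ∂μ) := by
        rw [ofReal_integral_eq_lintegral_ofReal habs
          (ae_of_all _ fun x => mul_nonneg hM0 (abs_nonneg _))]
    _ ≤ ENNReal.ofReal (max 1 (Real.log D) * ε) := by
        refine ENNReal.ofReal_le_ofReal ?_
        rw [integral_const_mul]
        exact mul_le_mul_of_nonneg_left hTV hM0

end Summit.QuantumFields.YangMills.Theorems.ColdStartUniversality.KLDensity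

end
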